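import Literature.Topology.FourManifolds.SurfaceGroupNielsenCoreSides
import Literature.Topology.FourManifolds.SurfaceGroupNielsenCoreSeparation2
import Literature.GroupTheory.CombinatorialGroupTheory.BinaryProductParity
import HarnessLib

/-!
# Nielsen's theorem, pillar CORE: a double point at a junction and a portal — shared lemmas

Topic `Literature/Topology/FourManifolds`.  Preparations for the case J-P of the case analysis
of a double point `a < b` on the closed path of a potential-minimal configuration
(Zieschang–Vogt–Coldewey, LNM 835, proof of Thm. 5.3.2 with Lemma 5.3.4, in the lead's
minimal-counterexample recasting): the cut `a` is the JUNCTION in front of the kernel of the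
occurrence `k₂` (`Kstart k₂ = a`, spur of length `c_a = jc (k₂ - 1)`), the cut `b` is a PORTAL,
interior to the kernel of the occurrence `k'` (between its slots `slotAt k' b - 1 | slotAt k' b`).

* the levels of the ends of a cancelling edge at a head slot and of a formal edge facing a head
  or a tail slot (`jp_level_cedge`, `jp_level_fedge_head`, `jp_level_fedge_tail`);
* **the crossing edges of the J-P fixation** (`jp_crossing_edges`): every crossing edge is the
  cancelling edge at a head slot `(k₂, e)`, `e < c_a`, of the `a`-spur (these do cross,
  `jp_isCrossing_cedge`) or the formal edge at a slot of the portal occurrence `k'` — for the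
  cancelling edges cross only inside the spur of a cut junction and the formal edges only for
  portal symbols (Claim (A));
* the vertex at the junction: `E_{k₂} = E_{k'} · V'[0, slotAt k' b) · (head k₂)⁻¹`
  (`jp_occStart_eq`), from `absv a = absv b`;
* the partners of the inside occurrences `k₂ ≤ j < k'` lie in `[k₂, k')` unless they are `k'`
  itself (`jp_bar_mem`, Claim (A)).

The two case theorems (partner of `k'` inside / outside) are in
`SurfaceGroupNielsenCoreCaseJP.lean`.

## References

* H. Zieschang, E. Vogt, H.-D. Coldewey, *Surfaces and Planar Discontinuous Groups*, LNM 835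
  (1980), proof of Thm. 5.3.2 and Lemma 5.3.4. [ZieschangVogtColdewey1980]
-/

noncomputable section

namespace Literature.Topology.FourManifolds

open Literature.GroupTheory.CombinatorialGroupTheory CycFactors List

namespace SurfaceGroup

variable {g : ℕ}

/-! ## A list helper -/

/-- Two lists agreeing letterwise below `c` have the same prefix of length `c`. [folklore] -/
theorem jp_take_eq_take {β : Type*} {L W : List β} {c : ℕ} (hL : c ≤ L.length) (hW : c ≤ W.length)
    (h : ∀ (e : ℕ) (h₁ : e < L.length) (h₂ : e < W.length), e < c → L[e] = W[e]) :
    L.take c = W.take c := by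
  refine List.ext_getElem (by rw [List.length_take, List.length_take]; omega) fun i h1 h2 => ?_
  rw [List.length_take] at h1 h2
  rw [List.getElem_take, List.getElem_take]
  exact h i (by omega) (by omega) (by omega)

/-! ## Levels of the ends of an edge -/

section Levels

variable {α : Type*} [DecidableEq α] {U : List (List (α × Bool))} {bar : ℕ → ℕ}

/-- All ends of the cancelling edge at a head slot have the level of that slot, its position.
[cite: ZieschangVogtColdewey1980, proof of Thm. 5.3.2] -/
theorem jp_level_cedge (hN : CycNielsen U) (hU : U ≠ []) (hb : IsPairing U bar) {σ : ℕ × ℕ}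
    (hh : IsHeadSlot U σ) : ∀ ρ ∈ (cedge U σ).2, level U ρ = σ.2 := fun _ hρ =>
  (isEdge_cedge (bar := bar) hh.1 fun hk => hk.not_isHeadSlot hh).level_eq_of_exists hN hU hb
    ⟨σ, mem_cedge.2 (Or.inl rfl), hh.level_eq hN⟩ hρ

/-- All ends of the formal edge at a slot facing a head slot have the level of that head slot,
its position. [cite: ZieschangVogtColdewey1980, proof of Thm. 5.3.2] -/
theorem jp_level_fedge_head (hN : CycNielsen U) (hU : U ≠ []) (hb : IsPairing U bar) {σ : ℕ × ℕ}
    (hσ : IsSlot U σ) (hh : IsHeadSlot U (fpartner U bar σ)) :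
    ∀ ρ ∈ (fedge U bar σ).2, level U ρ = (fpartner U bar σ).2 := fun _ hρ =>
  (isEdge_fedge hσ).level_eq_of_exists hN hU hb ⟨_, mem_fedge.2 (Or.inr rfl), hh.level_eq hN⟩ hρ

/-- All ends of the formal edge at a slot facing a tail slot have the level of that tail slot,
its depth. [cite: ZieschangVogtColdewey1980, proof of Thm. 5.3.2] -/
theorem jp_level_fedge_tail (hN : CycNielsen U) (hU : U ≠ []) (hb : IsPairing U bar) {σ : ℕ × ℕ}
    (hσ : IsSlot U σ) (ht : IsTailSlot U (fpartner U bar σ)) :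
    ∀ ρ ∈ (fedge U bar σ).2,
      level U ρ = (fac U (fpartner U bar σ).1).length - 1 - (fpartner U bar σ).2 := fun _ hρ =>
  (isEdge_fedge hσ).level_eq_of_exists hN hU hb ⟨_, mem_fedge.2 (Or.inr rfl), ht.level_eq hN⟩ hρ

end Levels

namespace Config

variable {φ : surfaceGen g → SurfaceGroup g}

section JPAux

variable (κ : Config φ) (hg : 1 ≤ g) (hI : Indecomposable φ) (hM : MarkedNontrivial φ)
  (hmin : κ.IsMin) (d : κ.DoublePoint)
include hg hI hM hmin

/-- **The crossing edges of the J-P fixation.**  For a double point `a < b` with `a` the junction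
in front of the kernel of `k₂` and `b` interior to the kernel of `k'`, every crossing edge of the
fixation is the cancelling edge at a head slot `(k₂, e)` of the `a`-spur (`e < jc (k₂ - 1)`) or
the formal edge at a slot of `k'`: cancelling edges cross only inside the spur of a cut junction
(and `b` is no junction), formal edges only for portal symbols (Claim (A); no occurrence is a
portal at the junction `a`). [cite: ZieschangVogtColdewey1980, Lemma 5.3.4] -/
theorem jp_crossing_edges {k₂ k' : ℕ} (hk₂ : k₂ < κ.w.length) (hKa : κ.Kstart k₂ = d.a)
    (hPb : κ.PortalAt d.b k') {s : ℕ × ℕ → Bool} (hs : ∀ σ, s σ = decide (κ.SideIn d.a d.b σ))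
    {ε : CycFactors.Edge} (hε : IsEdge κ.U κ.bar ε) (hc : IsCrossing s ε) :
    (∃ e, e < jc κ.U (cpred κ.U k₂) ∧ ε = cedge κ.U (k₂, e)) ∨
      (∃ q, q < (fac κ.U k').length ∧ ε = fedge κ.U κ.bar (k', q)) := by
  have hN := κ.cycNielsen_U hg hI hM hmin
  have hU := κ.U_ne_nil hg
  have hbar := κ.isPairing_bar
  have hab := d.lt
  have hbℓ := d.lt_length
  have hJa : κ.IsJunction d.a := ⟨k₂, hk₂, hKa⟩
  have hJb : ¬ κ.IsJunction d.b := κ.not_isJunction_of_portalAt hPb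
  have hsep : ∀ j, ¬ (κ.PortalAt d.a j ∧ κ.PortalAt d.b j) := fun j hj =>
    κ.not_portalAt_of_isJunction hJa j hj.1
  have hP2 := DoublePoint.kpos_mem_iff_of_chainEnd κ hg hI hM hmin d
  have hm0 : 0 < κ.w.length := by omega
  obtain ⟨σ', hσ', h' | ⟨hkσ', h'⟩⟩ := hε
  · subst h'
    right
    have hne := isCrossing_fedge.1 hc
    rw [hs, hs] at hne
    have hfc : κ.FCross d.a d.b σ' := (κ.fcross_iff_decide_ne _ _ _).2 hne
    rcases κ.exists_portalAt_of_fcross hg hI hM hmin hP2 hσ' hfc with h1 | h1 | h1 | h1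
    · exact absurd h1 (κ.not_portalAt_of_isJunction hJa _)
    · have e1 : σ'.1 = k' := κ.portalAt_unique h1 hPb
      obtain ⟨j, q⟩ := σ'
      simp only at e1
      subst e1
      exact ⟨q, hσ'.2, rfl⟩
    · exact absurd h1 (κ.not_portalAt_of_isJunction hJa _)
    · have e1 : κ.bar σ'.1 = k' := κ.portalAt_unique h1 hPb
      obtain ⟨j, q⟩ := σ'
      simp only at e1
      have hjU : j < κ.U.length := hσ'.1
      have hlen : (fac κ.U j).length = (fac κ.U k').length := by
        rw [← e1, hbar.length_fac_bar hjU]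
      have hq : q < (fac κ.U j).length := hσ'.2
      refine ⟨(fac κ.U k').length - 1 - q, by omega, ?_⟩
      rw [← fedge_fpartner hbar hσ']
      show fedge κ.U κ.bar (κ.bar j, (fac κ.U j).length - 1 - q) = _
      rw [e1, hlen]
  · subst h'
    left
    have hne := isCrossing_cedge.1 hc
    rw [hs, hs] at hne
    have hcc : κ.CCross d.a d.b σ' := (κ.ccross_iff_decide_ne hσ' hkσ').2 hne
    rcases hσ'.head_or_tail hkσ' with hh | ht
    · rcases (κ.ccross_iff_of_isHeadSlot hg hI hM hmin hab hbℓ hsep hh).1 hcc with h1 | h1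
      · have e1 : σ'.1 = k₂ := κ.Kstart_injective hg hI hM hmin (h1.trans hKa.symm)
        obtain ⟨j, e⟩ := σ'
        simp only at e1
        subst e1
        exact ⟨e, hh.2, rfl⟩
      · exact absurd ⟨σ'.1, by rw [← length_U]; exact hσ'.1, h1⟩ hJb
    · rcases (κ.ccross_iff_of_isTailSlot hg hI hM hmin hab hbℓ hsep ht).1 hcc with h1 | h1
      · have e1 : (σ'.1 + 1) % κ.w.length = k₂ :=
          κ.Kstart_injective hg hI hM hmin (h1.trans hKa.symm)
        have e2 : cget κ.U σ' = (k₂, (fac κ.U σ'.1).length - 1 - σ'.2) := by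
          rw [ht.cget_eq, length_U, e1]
        have hh := ht.isHeadSlot_cget
        rw [e2] at hh
        refine ⟨(fac κ.U σ'.1).length - 1 - σ'.2, hh.2, ?_⟩
        rw [← cedge_cget hN hU hσ' hkσ', e2]
      · exact absurd ⟨_, Nat.mod_lt _ hm0, h1⟩ hJb

/-- **The cancelling edges of the `a`-spur cross the fixation**: for the junction `a` in front of
the kernel of `k₂`, the cancelling edge at each head slot `(k₂, e)`, `e < jc (k₂ - 1)`, joins the
two sides. [cite: ZieschangVogtColdewey1980, Lemma 5.3.4] -/
theorem jp_isCrossing_cedge {k₂ : ℕ} (hk₂ : k₂ < κ.w.length) (hKa : κ.Kstart k₂ = d.a)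
    {s : ℕ × ℕ → Bool} (hs : ∀ σ, s σ = decide (κ.SideIn d.a d.b σ)) {e : ℕ}
    (he : e < jc κ.U (cpred κ.U k₂)) : IsCrossing s (cedge κ.U (k₂, e)) := by
  have hk₂U : k₂ < κ.U.length := by rw [length_U]; exact hk₂
  have hsep : ∀ j, ¬ (κ.PortalAt d.a j ∧ κ.PortalAt d.b j) := fun j hj =>
    κ.not_portalAt_of_isJunction ⟨k₂, hk₂, hKa⟩ j hj.1
  have hh : IsHeadSlot κ.U (k₂, e) :=
    ⟨⟨hk₂U, lt_of_lt_of_le he (jc_cpred_le_length κ.U k₂)⟩, he⟩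
  rw [isCrossing_cedge, hs, hs]
  exact (κ.ccross_iff_decide_ne hh.1 fun hk => hk.not_isHeadSlot hh).1
    ((κ.ccross_iff_of_isHeadSlot hg hI hM hmin d.lt d.lt_length hsep hh).2 (Or.inl hKa))

/-- **The vertex at the junction**: with `a = Kstart k₂` and `b` at the slot `slotAt k' b` of the
kernel of `k' < m`, `E_{k₂} = E_{k'} · V'[0, slotAt k' b) · (head k₂)⁻¹` — both sides describe
the common vertex `absv a = absv b`, reached as the base of the `a`-spur `E_{k₂} · head k₂` and
along the occurrence path of `k'`. [cite: ZieschangVogtColdewey1980, proof of Thm. 5.3.2] -/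
theorem jp_occStart_eq {k₂ k' : ℕ} (hk₂ : k₂ < κ.w.length) (hKa : κ.Kstart k₂ = d.a)
    (hPb : κ.PortalAt d.b k') :
    κ.occStart k₂ = κ.occStart k' *
      proj g (FreeGroup.mk ((fac κ.U k').take (κ.slotAt k' d.b))) *
        (proj g (FreeGroup.mk (CycFactors.head κ.U k₂)))⁻¹ := by
  have hN := κ.cycNielsen_U hg hI hM hmin
  have hk' : k' < κ.w.length := κ.lt_length_of_portalAt hPb d.lt_length.le
  obtain ⟨hs1, hs2⟩ := κ.slotAt_bounds_of_portalAt hg hI hM hmin hPb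
  have hva : κ.absv d.a = κ.occStart k₂ * proj g (FreeGroup.mk (CycFactors.head κ.U k₂)) := by
    rw [← hKa]
    exact κ.absv_Kstart hN hk₂.le
  have hvb : κ.absv d.b =
      κ.occStart k' * proj g (FreeGroup.mk ((fac κ.U k').take (κ.slotAt k' d.b))) := by
    have e : kpos κ.U (k', κ.slotAt k' d.b) = d.b := κ.kpos_slotAt hPb.1.le
    have h := κ.absv_kpos hN hk' hs1.le hs2.le
    rw [e] at h
    exact h
  have hvab : κ.absv d.a = κ.absv d.b := (κ.absv_eq_absv_iff _ _).2 d.pv_eq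
  rw [← hvb, ← hvab, hva, mul_inv_cancel_right]

/-- **Partners of the inside occurrences** (Claim (A)): with `a = Kstart k₂` and `b` interior to
the kernel of `k'`, the occurrences `k₂ ≤ j < k'` are inside, hence so are their partners, which
therefore lie in `[k₂, k')` — unless the partner is the portal occurrence `k'` itself.
[cite: ZieschangVogtColdewey1980, proof of Thm. 5.3.2 and Lemma 5.3.4] -/
theorem jp_bar_mem {k₂ k' : ℕ} (hk₂ : k₂ < κ.w.length) (hKa : κ.Kstart k₂ = d.a)
    (hPb : κ.PortalAt d.b k') {j : ℕ} (hj : j < κ.w.length) (h1 : k₂ ≤ j) (h2 : j < k')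
    (hbj : κ.bar j ≠ k') : k₂ ≤ κ.bar j ∧ κ.bar j < k' := by
  have hJa : κ.IsJunction d.a := ⟨k₂, hk₂, hKa⟩
  have hP2 := DoublePoint.kpos_mem_iff_of_chainEnd κ hg hI hM hmin d
  have hin : κ.Inside d.a d.b j :=
    ⟨by rw [← hKa]; exact κ.Kstart_mono h1, (κ.Kend_le_Kstart_of_lt h2).trans hPb.1.le⟩
  have hjk : j ≠ k' := by omega
  have hna : ¬ κ.PortalAt d.a j := κ.not_portalAt_of_isJunction hJa _
  have hnb : ¬ κ.PortalAt d.b j := fun h => hjk (κ.portalAt_unique h hPb)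
  have hna' : ¬ κ.PortalAt d.a (κ.bar j) := κ.not_portalAt_of_isJunction hJa _
  have hnb' : ¬ κ.PortalAt d.b (κ.bar j) := fun h => hbj (κ.portalAt_unique h hPb)
  obtain ⟨h3, h4⟩ := (κ.inside_iff_inside_bar hg hI hM hmin hP2 hj hna hnb hna' hnb').1 hin
  constructor
  · rw [← κ.Kstart_le_Kstart_iff hg hI hM hmin, hKa]
    exact h3
  · by_contra hle
    have := κ.Kend_le_Kend (not_lt.1 hle)
    have := hPb.2
    omega

end JPAux

end Config

end SurfaceGroup

end Literature.Topology.FourManifolds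

end
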